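import Summits.Ventures.Crystal3D.Theorems.StickyWulffConstantGenericWallFloorStackLedgerLocalCountSep
import Summits.Ventures.Crystal3D.Theorems.StickyWulffConstantGenericWallFloorStarLemma
import HarnessLib

/-!
# ONE STATE PER END BALL in the count form, and the per-class discharge of the pool hypothesis
# (crux `GenericWallFloor`, stmt-Ventures-19480, line `WallLedgerG`; the §51 side of the accounting theorem,
# cf-p1 (xlii‴) 2026-08-28T22:30Z «the honest λ the rows give per end-state class»)

HONEST FRAMING. Venture `Summits/Ventures/Crystal3D` (cell `crystal3d-full`), helper `--supports` the crux `GenericWallFloor`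
(stmt-Ventures-19480) of `route-Ventures-StickyWulffConstant`, REGISTERED line `WallLedgerG`, open stub `stub_twoSlabAdhesion`.
Rung credit only; F-C1 not moved; NOT the stub; census-free, standard axioms.

The priced one-sided ledger `twoSlabAdhesion_stackLedger_oneSided_pool` (…StackLedgerOneSidedPool, 19480-p2) takes the pool
inequality `λ · #ES ≤ Σ_{PAY} (12 − deg)` over the inner certified END STATES of one walker family as the hypothesis `hpool`; the
count lemma gives it at `λ = 1` (`pool_of_count`), one unit of the end ball's deficiency PER STATE.  The §51 rows
(`endBall_row`, …EndBallRow) are keyed on the END BALL `y` and carry the COUNT FORM hypothesis `deg y ≤ k_F + 1`, `k_F` = the number of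
occupied exact `F`-slots of `y` for the top frame `F` of the stopped walker.  This file proves that the two book-keepings agree there:

* `exists_adjacent_pair_opposite` — slot combinatorics: opposite to any slot `v` there are two ADJACENT slots (`⟪a, v⟫ = ⟪b, v⟫ = −½`,
  `⟪a, b⟫ = ½`); with `−v` they span the closed vertex star of `−v`.
* **`coaxial_of_star_owned_of_count`** — if a ball `y` owns the closed star of `(F, v)` (`y + F w ∈ X` for `⟪w, v⟫ < 0`) and is in
  COUNT FORM for a frame `F₀` (at most one contact of `y` off the exact `F₀`-slots), then `F₀·Λ₀` and `F·Λ₀` are co-axial: of the three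
  star points `y − F v`, `y + F a`, `y + F b` at most one is off the `F₀`-slots, and any two of them are `60°`-adjacent
  (`coaxial_of_shared_adjacent_slots`).
* **`card_endStates_le_one_of_count`** — ONE STATE PER END BALL: if some state of the family at `y` is in count form for its top frame,
  the family has at most one end state at `y` (two different states have NON-co-axial top frames, `not_coaxial_of_two_states`).  So in
  count form the credit PER STATE is the whole own deficiency `12 − deg y`, not one unit.
* **`pool_of_slotCount`** — the per-class discharge of `hpool`, in the shape of its antecedent (…StackLedgerOneSidedPool, verbatim up to
  the window bounds `lo, hi`): if every state of `ES` is in count form for its top frame and its ball has `deg ≤ 12 − λ`, then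
  `λ · #ES ≤ Σ_{PAY} (12 − deg)`.  The honest classes: `λ = 2` when the top frame has at most nine occupied slots (`deg ≤ k + 1 ≤ 10`:
  `pool_of_threeEmptySlots`), `λ = 12 − deg y` in general count form; outside the count form (`deg y ≥ k_F + 2`, the «defective twin
  caps») the count lemma's one unit per state is all there is.

WHAT THIS IS NOT: no discharge of `hpool` for `λ > 1` on ALL fillings — the class hypotheses are genuine (memo HONEST-LAMBDA-g12 on the
item: the «(9,2) honeycomb» decoration puts EVERY line end outside these classes at certified credit exactly `1`); F-C1 not moved.
-/

noncomputable section

namespace Summit.Ventures.Crystal3D.Theorems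

open Summit.Ventures.Crystal3D Finset NearIdentity
open Literature.MathematicalPhysics.StatisticalMechanics (fccStacking barlowStacking IsHaggSeq)
open scoped InnerProductSpace

variable {X : Finset (EuclideanSpace ℝ (Fin 3))}

/-! ### Slot combinatorics: an adjacent pair opposite to a slot -/

/-- Opposite to any slot `v` there are two ADJACENT slots: `⟪a, v⟫ = ⟪b, v⟫ = −½` and `⟪a, b⟫ = ½`. -/
theorem exists_adjacent_pair_opposite {v : EuclideanSpace ℝ (Fin 3)} (hv : v ∈ fccSlots) :
    ∃ a ∈ fccSlots, ∃ b ∈ fccSlots, ⟪a, v⟫_ℝ = -(1 / 2) ∧ ⟪b, v⟫_ℝ = -(1 / 2) ∧ ⟪a, b⟫_ℝ = 1 / 2 := by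
  obtain ⟨g, hg, -, hgs⟩ := exists_latticeIso_map_slot (slotSite_mem 0) hv
  have h6 : (slotInt 6 ⬝ᵥ slotInt 0 : ℤ) = -1 := by decide
  have h10 : (slotInt 10 ⬝ᵥ slotInt 0 : ℤ) = -1 := by decide
  have h610 : (slotInt 6 ⬝ᵥ slotInt 10 : ℤ) = 1 := by decide
  refine ⟨g (slotSite 6), map_mem_fccSlots g hg (slotSite_mem 6), g (slotSite 10), map_mem_fccSlots g hg (slotSite_mem 10),
    ?_, ?_, ?_⟩
  · rw [← hgs, LinearIsometryEquiv.inner_map_map, inner_slotSite, h6]; norm_num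
  · rw [← hgs, LinearIsometryEquiv.inner_map_map, inner_slotSite, h10]; norm_num
  · rw [LinearIsometryEquiv.inner_map_map, inner_slotSite, h610]; norm_num

/-! ### An owned star in count form forces co-axial frames -/

open scoped Classical in
/-- **An owned star at a ball in count form lies on the slots.**  `X` is `1`-separated; the ball `y` owns the closed vertex star of
`(F, v)` (`y + F w ∈ X` whenever `⟪w, v⟫ < 0`) and is in COUNT FORM for the frame `F₀`: its number of contacts is at most one more than
the number of occupied exact `F₀`-slots.  Then the linear lattices `F₀·Λ₀`, `F·Λ₀` are co-axial. -/
theorem coaxial_of_star_owned_of_count {y : EuclideanSpace ℝ (Fin 3)}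
    {F₀ F : EuclideanSpace ℝ (Fin 3) ≃ₗᵢ[ℝ] EuclideanSpace ℝ (Fin 3)} {v : EuclideanSpace ℝ (Fin 3)} (hv : v ∈ fccSlots)
    (hown : ∀ w ∈ fccSlots, ⟪w, v⟫_ℝ < 0 → y + F w ∈ X)
    (hcount : (X.filter fun q => dist y q = 1).card ≤
      (Finset.univ.filter fun i : Fin 12 => y + F₀ (slotSite i) ∈ X).card + 1) :
    ∃ (L : EuclideanSpace ℝ (Fin 3) ≃ₗᵢ[ℝ] EuclideanSpace ℝ (Fin 3))
      (s₁ s₂ : EuclideanSpace ℝ (Fin 3)) (σ σ' : ℤ → ℤ), IsHaggSeq σ ∧ IsHaggSeq σ' ∧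
      F₀ '' fccStacking 1 (Real.sqrt (2 / 3)) ⊆ (fun p => L p + s₁) '' barlowStacking 1 (Real.sqrt (2 / 3)) σ ∧
      F '' fccStacking 1 (Real.sqrt (2 / 3)) ⊆ (fun p => L p + s₂) '' barlowStacking 1 (Real.sqrt (2 / 3)) σ' := by
  -- the contacts `N` and the on-slot contacts `S`
  set N := X.filter fun q => dist y q = 1 with hN
  set I := Finset.univ.filter fun i : Fin 12 => y + F₀ (slotSite i) ∈ X with hI
  set S := I.image fun i => y + F₀ (slotSite i) with hS
  have hSN : S ⊆ N := by
    intro q hq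
    obtain ⟨i, hi, rfl⟩ := Finset.mem_image.1 hq
    refine Finset.mem_filter.2 ⟨(Finset.mem_filter.1 hi).2, ?_⟩
    rw [dist_self_add_right, LinearIsometryEquiv.norm_map, norm_eq_one_of_mem_fccSlots (slotSite_mem i)]
  have hScard : S.card = I.card :=
    Finset.card_image_of_injective _ fun i j h => slotSite_injective (F₀.injective (add_left_cancel h))
  have hdiff : (N \ S).card ≤ 1 := by
    rw [Finset.card_sdiff_of_subset hSN, hScard]; omega
  -- at most one contact off the slots
  have hoff : ∀ p ∈ N, ∀ q ∈ N, p ∉ S → q ∉ S → p = q := fun p hp q hq hpS hqS =>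
    Finset.card_le_one.1 hdiff p (Finset.mem_sdiff.2 ⟨hp, hpS⟩) q (Finset.mem_sdiff.2 ⟨hq, hqS⟩)
  -- star points are contacts; on-slot star points are `F₀`-lattice vectors
  have hstarN : ∀ w ∈ fccSlots, ⟪w, v⟫_ℝ < 0 → y + F w ∈ N := fun w hw hneg =>
    Finset.mem_filter.2 ⟨hown w hw hneg, by
      rw [dist_self_add_right, LinearIsometryEquiv.norm_map, norm_eq_one_of_mem_fccSlots hw]⟩
  have hlat : ∀ w ∈ fccSlots, y + F w ∈ S → F w ∈ F₀ '' fccStacking 1 (Real.sqrt (2 / 3)) := by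
    intro w _ hwS
    obtain ⟨i, -, hi⟩ := Finset.mem_image.1 hwS
    exact ⟨slotSite i, mem_fcc_of_mem_fccSlots (slotSite_mem i), add_left_cancel hi⟩
  -- two adjacent on-slot star points give co-axiality
  have key : ∀ w₁ ∈ fccSlots, ∀ w₂ ∈ fccSlots, ⟪w₁, w₂⟫_ℝ = 1 / 2 → y + F w₁ ∈ S → y + F w₂ ∈ S →
      ∃ (L : EuclideanSpace ℝ (Fin 3) ≃ₗᵢ[ℝ] EuclideanSpace ℝ (Fin 3))
        (s₁ s₂ : EuclideanSpace ℝ (Fin 3)) (σ σ' : ℤ → ℤ), IsHaggSeq σ ∧ IsHaggSeq σ' ∧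
        F₀ '' fccStacking 1 (Real.sqrt (2 / 3)) ⊆ (fun p => L p + s₁) '' barlowStacking 1 (Real.sqrt (2 / 3)) σ ∧
        F '' fccStacking 1 (Real.sqrt (2 / 3)) ⊆ (fun p => L p + s₂) '' barlowStacking 1 (Real.sqrt (2 / 3)) σ' := by
    intro w₁ hw₁ w₂ hw₂ h12 h₁ h₂
    have haff := coaxial_of_shared_adjacent_slots F₀ F 0 0 (F w₁) (F w₂) (hlat w₁ hw₁ h₁) (hlat w₂ hw₂ h₂)
      ⟨w₁, mem_fcc_of_mem_fccSlots hw₁, rfl⟩ ⟨w₂, mem_fcc_of_mem_fccSlots hw₂, rfl⟩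
      (by rw [LinearIsometryEquiv.norm_map, norm_eq_one_of_mem_fccSlots hw₁])
      (by rw [LinearIsometryEquiv.norm_map, norm_eq_one_of_mem_fccSlots hw₂])
      (by rw [LinearIsometryEquiv.inner_map_map, h12])
    simpa only [add_zero] using haff
  -- the three star slots `−v`, `a`, `b`
  obtain ⟨a, ha, b, hb, hav, hbv, hab⟩ := exists_adjacent_pair_opposite hv
  have hnv : -v ∈ fccSlots := neg_mem_fccSlots hv
  have hvv : ⟪v, v⟫_ℝ = 1 := by rw [real_inner_self_eq_norm_sq, norm_eq_one_of_mem_fccSlots hv, one_pow]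
  have hnvv : ⟪-v, v⟫_ℝ < 0 := by rw [inner_neg_left, hvv]; norm_num
  have haneg : ⟪a, v⟫_ℝ < 0 := by rw [hav]; norm_num
  have hbneg : ⟪b, v⟫_ℝ < 0 := by rw [hbv]; norm_num
  have hna : ⟪-v, a⟫_ℝ = 1 / 2 := by rw [inner_neg_left, real_inner_comm, hav]; norm_num
  have hnb : ⟪-v, b⟫_ℝ = 1 / 2 := by rw [inner_neg_left, real_inner_comm, hbv]; norm_num
  -- the three star points are pairwise distinct
  have hne : ∀ w₁ ∈ fccSlots, ∀ w₂ ∈ fccSlots, ⟪w₁, w₂⟫_ℝ = 1 / 2 → y + F w₁ ≠ y + F w₂ := by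
    intro w₁ hw₁ w₂ _ h12 h
    have hw : w₁ = w₂ := F.injective (add_left_cancel h)
    rw [hw, real_inner_self_eq_norm_sq, norm_eq_one_of_mem_fccSlots (hw ▸ hw₁)] at h12
    norm_num at h12
  by_cases hvS : y + F (-v) ∈ S
  · by_cases haS : y + F a ∈ S
    · exact key (-v) hnv a ha hna hvS haS
    · have hbS : y + F b ∈ S := by
        by_contra hbS
        exact hne a ha b hb hab (hoff _ (hstarN a ha haneg) _ (hstarN b hb hbneg) haS hbS)
      exact key (-v) hnv b hb hnb hvS hbS
  · have haS : y + F a ∈ S := by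
      by_contra haS
      exact hne (-v) hnv a ha hna (hoff _ (hstarN (-v) hnv hnvv) _ (hstarN a ha haneg) hvS haS)
    have hbS : y + F b ∈ S := by
      by_contra hbS
      exact hne (-v) hnv b hb hnb (hoff _ (hstarN (-v) hnv hnvv) _ (hstarN b hb hbneg) hvS hbS)
    exact key a ha b hb hab haS hbS

/-! ### One state per end ball -/

/-- **ONE STATE PER END BALL (count form).**  `X` is `1`-separated; `ES` is a finite set of states of ONE walker family at the ball `y`
(walk invariant, well-formed stacks, a common bottom entry `b₁`, the strong certificate at the top).  If some state `s₀ ∈ ES` is in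
COUNT FORM for its top frame `e₀.frame` — `deg y ≤ #{i : y + e₀.frame (slotSite i) ∈ X} + 1`, the hypothesis of `endBall_row` — then
`ES` has at most one element: every state at `y` is `s₀`. -/
theorem card_endStates_le_one_of_count (hX : ∀ p ∈ X, ∀ q ∈ X, p ≠ q → 1 ≤ dist p q)
    {b₁ : WalkEntry} {z y : EuclideanSpace ℝ (Fin 3)} (ES : Finset (EuclideanSpace ℝ (Fin 3) × List WalkEntry))
    (h₁ : ∀ s ∈ ES, s.1 = y ∧ WalkInv X z s ∧ StackWF z s.2 ∧ s.2.getLast? = some b₁ ∧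
      ∃ e rest, s.2 = e :: rest ∧ WalkCertified12 X y e)
    {s₀ : EuclideanSpace ℝ (Fin 3) × List WalkEntry} (hs₀ : s₀ ∈ ES) {e₀ : WalkEntry} {rest₀ : List WalkEntry}
    (he₀ : s₀.2 = e₀ :: rest₀)
    (hcount : (X.filter fun q => dist y q = 1).card ≤
      (Finset.univ.filter fun i : Fin 12 => y + e₀.frame (slotSite i) ∈ X).card + 1) :
    ES.card ≤ 1 := by
  classical
  -- data of the distinguished state
  obtain ⟨hy₀, hI₀, hW₀, hlast₀, -⟩ := h₁ s₀ hs₀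
  obtain ⟨-, hS₀, e₀', rest₀', hstk₀, hC₀⟩ := hI₀
  rw [he₀] at hstk₀ hS₀ hW₀ hlast₀
  injection hstk₀ with he _
  subst he
  rw [hy₀] at hC₀
  -- every state is `s₀`
  refine Finset.card_le_one.2 fun s hs s' hs' => ?_
  suffices hall : ∀ s ∈ ES, s = s₀ by rw [hall s hs, hall s' hs']
  intro s hs
  by_contra hne
  obtain ⟨hy, hI, hW, hlast, -⟩ := h₁ s hs
  obtain ⟨-, hS, e, rest, hstk, hC⟩ := hI
  rw [hstk] at hS hW hlast
  rw [hy] at hC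
  have hstne : e₀ :: rest₀ ≠ e :: rest := by
    intro h; apply hne
    exact Prod.ext (by rw [hy, hy₀]) (by rw [hstk, he₀, h])
  have hnc := not_coaxial_of_two_states hX hS₀ hW₀ hC₀ hS hW hC (hlast₀.trans hlast.symm) hstne
  have hdir : e.dir ∈ fccSlots := (hS.top).1
  exact hnc (coaxial_of_star_owned_of_count hdir (star_owned_of_walkCertified hdir hC) hcount)

/-- **ONE STATE PER END BALL**, membership form: under the hypotheses of `card_endStates_le_one_of_count`, `ES = {s₀}`. -/
theorem endStates_eq_singleton_of_count (hX : ∀ p ∈ X, ∀ q ∈ X, p ≠ q → 1 ≤ dist p q)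
    {b₁ : WalkEntry} {z y : EuclideanSpace ℝ (Fin 3)} (ES : Finset (EuclideanSpace ℝ (Fin 3) × List WalkEntry))
    (h₁ : ∀ s ∈ ES, s.1 = y ∧ WalkInv X z s ∧ StackWF z s.2 ∧ s.2.getLast? = some b₁ ∧
      ∃ e rest, s.2 = e :: rest ∧ WalkCertified12 X y e)
    {s₀ : EuclideanSpace ℝ (Fin 3) × List WalkEntry} (hs₀ : s₀ ∈ ES) {e₀ : WalkEntry} {rest₀ : List WalkEntry}
    (he₀ : s₀.2 = e₀ :: rest₀)
    (hcount : (X.filter fun q => dist y q = 1).card ≤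
      (Finset.univ.filter fun i : Fin 12 => y + e₀.frame (slotSite i) ∈ X).card + 1) :
    ES = {s₀} :=
  Finset.eq_singleton_iff_unique_mem.2 ⟨hs₀, fun s hs =>
    Finset.card_le_one.1 (card_endStates_le_one_of_count hX ES h₁ hs₀ he₀ hcount) s hs s₀ hs₀⟩

/-! ### The per-class discharge of the pool hypothesis -/

open scoped Classical in
/-- **`hpool` on the COUNT-FORM class with credit `λ`.**  In the shape of the antecedent of `twoSlabAdhesion_stackLedger_oneSided_pool`
(window bounds `lo, hi`; ONE family with bottom entry `b₁`): if every state of `ES` is in count form for its top frame and its ball has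
at most `12 − λ` contacts, then `λ · #ES ≤ Σ_{PAY} (12 − deg)`.  (By `card_endStates_le_one_of_count` the states are in bijection
with their balls, and each ball is a payer with credit `12 − deg ≥ λ`.) -/
theorem pool_of_slotCount (hX : ∀ p ∈ X, ∀ q ∈ X, p ≠ q → 1 ≤ dist p q)
    {z : EuclideanSpace ℝ (Fin 3)} {b₁ : WalkEntry} (lo hi lam : ℝ)
    (ES : Finset (EuclideanSpace ℝ (Fin 3) × List WalkEntry))
    (hES : ∀ s ∈ ES, s.1 ∈ X ∧ (lo ≤ s.1 2 ∧ s.1 2 ≤ hi) ∧ (X.filter fun q => dist s.1 q = 1).card ≤ 11 ∧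
      WalkInv X z s ∧ StackWF z s.2 ∧ s.2.getLast? = some b₁ ∧ (∃ e rest, s.2 = e :: rest ∧ WalkCertified12 X s.1 e))
    (hcls : ∀ s ∈ ES, ∃ e rest, s.2 = e :: rest ∧
      (X.filter fun q => dist s.1 q = 1).card ≤ (Finset.univ.filter fun i : Fin 12 => s.1 + e.frame (slotSite i) ∈ X).card + 1 ∧
      lam ≤ 12 - ((X.filter fun q => dist s.1 q = 1).card : ℝ)) :
    lam * (ES.card : ℝ) ≤ ∑ y ∈ X.filter (fun y => (X.filter fun q => dist y q = 1).card ≠ 12 ∧ lo ≤ y 2 ∧ y 2 ≤ hi),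
      ((12 : ℝ) - ((X.filter fun q => dist y q = 1).card : ℝ)) := by
  set PAY := X.filter (fun y => (X.filter fun q => dist y q = 1).card ≠ 12 ∧ lo ≤ y 2 ∧ y 2 ≤ hi) with hPAY
  -- every end ball is a payer
  have hmemPAY : ∀ s ∈ ES, s.1 ∈ PAY := by
    intro s hs
    obtain ⟨hyX, hwin, hdeg, -⟩ := hES s hs
    rw [hPAY, Finset.mem_filter]; exact ⟨hyX, by omega, hwin⟩
  -- fibrewise: at most one state per ball, credit `≥ λ` per occupied fibre
  have hsum : ES.card = ∑ y ∈ PAY, (ES.filter fun s => s.1 = y).card :=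
    Finset.card_eq_sum_card_fiberwise fun s hs => hmemPAY s hs
  have hpt : ∀ y ∈ PAY, lam * ((ES.filter fun s => s.1 = y).card : ℝ) ≤
      (12 : ℝ) - ((X.filter fun q => dist y q = 1).card : ℝ) := by
    intro y _
    set fib := ES.filter fun s => s.1 = y with hfib
    by_cases hemp : fib = ∅
    · rw [hemp, Finset.card_empty, Nat.cast_zero, mul_zero]
      have : ((X.filter fun q => dist y q = 1).card : ℝ) ≤ 12 := by exact_mod_cast card_filter_dist_eq_one_le_twelve X hX y
      linarith
    obtain ⟨s₀, hs₀⟩ := Finset.nonempty_iff_ne_empty.2 hemp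
    obtain ⟨hs₀E, hs₀y⟩ := Finset.mem_filter.1 hs₀
    obtain ⟨e₀, rest₀, he₀, hcount, hlam⟩ := hcls s₀ hs₀E
    rw [hs₀y] at hcount hlam
    have hfib1 : fib.card ≤ 1 := by
      refine card_endStates_le_one_of_count hX (b₁ := b₁) (z := z) (y := y) fib (fun s hs => ?_) hs₀ he₀ hcount
      obtain ⟨hsE, hsy⟩ := Finset.mem_filter.1 hs
      obtain ⟨-, -, -, hI, hW, hlast, hC⟩ := hES s hsE
      rw [hsy] at hC; exact ⟨hsy, hI, hW, hlast, hC⟩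
    have h1 : (fib.card : ℝ) ≤ 1 := by exact_mod_cast hfib1
    have hlam0 : lam * (fib.card : ℝ) ≤ lam * 1 := by
      rcases le_or_gt 0 lam with hl | hl
      · exact mul_le_mul_of_nonneg_left h1 hl
      · have hc1 : (1 : ℝ) ≤ fib.card := by
          have : 1 ≤ fib.card := Finset.card_pos.2 ⟨s₀, hs₀⟩
          exact_mod_cast this
        nlinarith
    linarith
  calc lam * (ES.card : ℝ) = ∑ y ∈ PAY, lam * ((ES.filter fun s => s.1 = y).card : ℝ) := by
        rw [hsum, Nat.cast_sum, Finset.mul_sum]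
    _ ≤ ∑ y ∈ PAY, ((12 : ℝ) - ((X.filter fun q => dist y q = 1).card : ℝ)) := Finset.sum_le_sum hpt

open scoped Classical in
/-- **The `λ = 2` class: at least three empty exact slots.**  If every state of `ES` is in count form for its top frame and that frame
has at most NINE occupied slots at the ball (so `deg ≤ k + 1 ≤ 10`), then `2 · #ES ≤ Σ_{PAY} (12 − deg)`. -/
theorem pool_of_threeEmptySlots (hX : ∀ p ∈ X, ∀ q ∈ X, p ≠ q → 1 ≤ dist p q)
    {z : EuclideanSpace ℝ (Fin 3)} {b₁ : WalkEntry} (lo hi : ℝ)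
    (ES : Finset (EuclideanSpace ℝ (Fin 3) × List WalkEntry))
    (hES : ∀ s ∈ ES, s.1 ∈ X ∧ (lo ≤ s.1 2 ∧ s.1 2 ≤ hi) ∧ (X.filter fun q => dist s.1 q = 1).card ≤ 11 ∧
      WalkInv X z s ∧ StackWF z s.2 ∧ s.2.getLast? = some b₁ ∧ (∃ e rest, s.2 = e :: rest ∧ WalkCertified12 X s.1 e))
    (hcls : ∀ s ∈ ES, ∃ e rest, s.2 = e :: rest ∧
      (X.filter fun q => dist s.1 q = 1).card ≤ (Finset.univ.filter fun i : Fin 12 => s.1 + e.frame (slotSite i) ∈ X).card + 1 ∧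
      (Finset.univ.filter fun i : Fin 12 => s.1 + e.frame (slotSite i) ∈ X).card ≤ 9) :
    2 * (ES.card : ℝ) ≤ ∑ y ∈ X.filter (fun y => (X.filter fun q => dist y q = 1).card ≠ 12 ∧ lo ≤ y 2 ∧ y 2 ≤ hi),
      ((12 : ℝ) - ((X.filter fun q => dist y q = 1).card : ℝ)) := by
  refine pool_of_slotCount hX lo hi 2 ES hES fun s hs => ?_
  obtain ⟨e, rest, hse, hcount, hk⟩ := hcls s hs
  refine ⟨e, rest, hse, hcount, ?_⟩
  have : ((X.filter fun q => dist s.1 q = 1).card : ℝ) ≤ 10 := by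
    have h' : (X.filter fun q => dist s.1 q = 1).card ≤ 10 := by omega
    exact_mod_cast h'
  linarith

end Summit.Ventures.Crystal3D.Theorems

end
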